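import Mathlib
import Summits.RiemannHypothesis.RiemannHypothesis.Theorems.SoloBlindLatticeTwoSheet

/-!
# Theorem D4: an off-line pair lattice is VISIBLE on windows holding between one and two periods
(solo-blind artefact 8b; uses the two-sheet lattice formula of `SoloBlindLatticeTwoSheet`)

For a window `(-a, a]` and a lattice `u_j = u₀ + j s` with `π/a < s ≤ 2π/a` (period `T = 2π/s ∈ [a, 2a)`),
the explicit two-block step function `g = 1_{(-a, -a+ℓ]} - e^{-iu₀T} 1_{(-a+T, a]}`, `ℓ = 2a - T`, has
`Σ_j 2 Re[H_g(u_j - iδ) conj H_g(u_j + iδ)] = 4 T ℓ (1 - cosh(δT))` (`soloBlind_pairLattice_visible`),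
which is `< 0` for `δ ≠ 0` (`soloBlind_pairLattice_visible_neg`).  (At `δ = 0` the same `g` annihilates
the lattice: `H_g(u_j) = 0` for all `j`.)  Reading, with the erratum recorded in `SoloBlindLatticeTwoSheet`:
at the zeta density the all-off-line pair crystal has ordinate spacing `4π/log(T_h/2π)`, so it is
invisible at window `a` from `log(T_h/2π) ≥ 4a` (artefact 7) and visible on `2a ≤ log(T_h/2π) < 4a`
(this file).  Statements are about the abstract functional only, not about `ζ`.
-/

open MeasureTheory Complex Set AddCircle
open scoped Real ComplexConjugate

namespace Summit.RiemannHypothesis.RiemannHypothesis.Theorems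

/-- Square-norm of the two-block step function `1_{(p,q]} + α 1_{(p+T,q+T]}` (`‖α‖ = 1`, blocks disjoint). -/
theorem soloBlind_twoBlock_sqNorm (p q T : ℝ) (α : ℂ) (hpq : p ≤ q) (hqT : q ≤ p + T) (hα : ‖α‖ = 1)
    {g : ℝ → ℂ} (hgW : g = fun x => (Ioc p q).indicator (fun _ => (1 : ℂ)) x +
      (Ioc (p + T) (q + T)).indicator (fun _ => α) x) :
    (∫ x : ℝ, ‖g x‖ ^ 2) = 2 * (q - p) := by
  have hpt : ∀ x, ‖g x‖ ^ 2 = (Ioc p q).indicator (fun _ => (1 : ℝ)) x +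
      (Ioc (p + T) (q + T)).indicator (fun _ => (1 : ℝ)) x := by
    intro x
    by_cases h1 : x ∈ Ioc p q
    · have h2 : x ∉ Ioc (p + T) (q + T) := fun h => by linarith [h1.2, h.1]
      simp [hgW, h1, h2]
    · by_cases h2 : x ∈ Ioc (p + T) (q + T)
      · simp [hgW, h1, h2, hα]
      · simp [hgW, h1, h2]
  simp_rw [hpt]
  rw [integral_add, integral_indicator_const _ measurableSet_Ioc, integral_indicator_const _ measurableSet_Ioc,
    Real.volume_real_Ioc, Real.volume_real_Ioc, smul_eq_mul, smul_eq_mul, mul_one,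
    max_eq_left (by linarith), max_eq_left (by linarith)]
  · ring
  · exact memLp_one_iff_integrable.mp
      (memLp_indicator_const 1 measurableSet_Ioc (1 : ℝ) (Or.inr (by simp [Real.volume_Ioc])))
  · exact memLp_one_iff_integrable.mp
      (memLp_indicator_const 1 measurableSet_Ioc (1 : ℝ) (Or.inr (by simp [Real.volume_Ioc])))

/-- Shift correlation of the two-block step function: `∫ conj g(x) g(x+T) dx = (q - p) α`. -/
theorem soloBlind_twoBlock_corr (p q T : ℝ) (α : ℂ) (hpq : p ≤ q) (hqT : q ≤ p + T)
    {g : ℝ → ℂ} (hgW : g = fun x => (Ioc p q).indicator (fun _ => (1 : ℂ)) x +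
      (Ioc (p + T) (q + T)).indicator (fun _ => α) x) :
    (∫ x : ℝ, conj (g x) * g (x + T)) = (((q - p : ℝ)) : ℂ) * α := by
  have hT0 : 0 ≤ T := by linarith
  have hpt : ∀ x, conj (g x) * g (x + T) = (Ioc p q).indicator (fun _ => α) x := by
    intro x
    by_cases h1 : x ∈ Ioc p q
    · have h2 : x ∉ Ioc (p + T) (q + T) := fun h => by linarith [h1.2, h.1]
      have h3 : x + T ∈ Ioc (p + T) (q + T) := ⟨by linarith [h1.1], by linarith [h1.2]⟩
      have h4 : x + T ∉ Ioc p q := fun h => by linarith [h1.1, h.2]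
      simp [hgW, h1, h2, h3, h4]
    · by_cases h2 : x ∈ Ioc (p + T) (q + T)
      · have h3 : x + T ∉ Ioc (p + T) (q + T) := fun h => by linarith [h2.1, h.2]
        have h4 : x + T ∉ Ioc p q := fun h => by linarith [h2.1, h.2]
        simp [hgW, h1, h2, h3, h4]
      · simp [hgW, h1, h2]
  simp_rw [hpt]
  rw [integral_indicator_const _ measurableSet_Ioc, Real.volume_real_Ioc, max_eq_left (by linarith),
    Complex.real_smul]

/-- **Theorem D4 of the report: the off-line pair lattice is VISIBLE on windows holding between one and two
periods.**  Let `0 < a`, `π/a < s ≤ 2π/a` (so `T = 2π/s ∈ [a, 2a)`), `ℓ = 2a - T`, and let `g` be the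
two-block step function `1_{(-a, -a+ℓ]} - e^{-iu₀T} 1_{(-a+T, a]}` (supported in the window `(-a, a]`).
Then `Σ_j 2 Re[H_g(u_j - iδ) conj H_g(u_j + iδ)] = 4 T ℓ (1 - cosh(δ T))`. -/
theorem soloBlind_pairLattice_visible (a s u₀ δ : ℝ) (ha : 0 < a) (hs1 : π / a < s)
    (hs2 : s ≤ 2 * π / a) {g : ℝ → ℂ}
    (hgW : g = fun x => (Ioc (-a) (-a + (2 * a - 2 * π / s))).indicator (fun _ => (1 : ℂ)) x +
      (Ioc (-a + 2 * π / s) (-a + (2 * a - 2 * π / s) + 2 * π / s)).indicator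
        (fun _ => -cexp (-(((u₀ * (2 * π / s) : ℝ) : ℂ) * I))) x) :
    HasSum (fun j : ℤ => 2 *
        ((∫ x : ℝ, g x * cexp (I * (((u₀ + j * s : ℝ) : ℂ) - I * δ) * x)) *
         conj (∫ x : ℝ, g x * cexp (I * (((u₀ + j * s : ℝ) : ℂ) + I * δ) * x))).re)
      (4 * (2 * π / s) * (2 * a - 2 * π / s) * (1 - Real.cosh (δ * (2 * π / s)))) := by
  set T : ℝ := 2 * π / s with hTdef
  have hπ : 0 < π := Real.pi_pos
  have hs : 0 < s := lt_trans (by positivity) hs1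
  have hT : 0 < T := by rw [hTdef]; positivity
  have hTa : a ≤ T := by
    rw [hTdef, le_div_iff₀ hs]
    rw [le_div_iff₀ ha] at hs2
    linarith
  have hT2a : T < 2 * a := by
    rw [hTdef, div_lt_iff₀ hs]
    rw [div_lt_iff₀ ha] at hs1
    linarith
  set ℓ : ℝ := 2 * a - T with hℓdef
  set α : ℂ := -cexp (-(((u₀ * T : ℝ) : ℂ) * I)) with hαdef
  have hα : ‖α‖ = 1 := by
    rw [hαdef, norm_neg, show -(((u₀ * T : ℝ) : ℂ) * I) = ((-(u₀ * T) : ℝ) : ℂ) * I by push_cast; ring,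
      Complex.norm_exp_ofReal_mul_I]
  have hpq : -a ≤ -a + ℓ := by rw [hℓdef]; linarith
  have hqT : -a + ℓ ≤ -a + T := by rw [hℓdef]; linarith
  -- `g ∈ L²` with support in two periods
  have hgL2 : MemLp g 2 volume := by
    rw [hgW]
    exact (memLp_indicator_const 2 measurableSet_Ioc (1 : ℂ) (Or.inr (by simp [Real.volume_Ioc]))).add
      (memLp_indicator_const 2 measurableSet_Ioc α (Or.inr (by simp [Real.volume_Ioc])))
  have hsupp : Function.support g ⊆ Ioc (-a) (-a + 4 * π / s) := by
    have h4 : -a + 4 * π / s = -a + T + T := by rw [hTdef]; ring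
    rw [h4, hgW]
    refine (Function.support_add _ _).trans (union_subset ?_ ?_)
    · exact Set.support_indicator_subset.trans (Ioc_subset_Ioc le_rfl (by linarith))
    · exact Set.support_indicator_subset.trans (Ioc_subset_Ioc (by linarith) (by linarith))
  have main := soloBlind_lattice_twoSheet (-a) s u₀ δ hs hgL2 hsupp
  rw [← hTdef] at main
  have hN := soloBlind_twoBlock_sqNorm (-a) (-a + ℓ) T α hpq hqT hα hgW
  have hK := soloBlind_twoBlock_corr (-a) (-a + ℓ) T α hpq hqT hgW
  rw [hN, hK] at main
  have h2 := (main.mapL Complex.reCLM).mul_left (2 : ℝ)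
  simp only [Complex.reCLM_apply] at h2
  -- evaluate the real part
  have he1 : cexp (((u₀ * T : ℝ) : ℂ) * I) * α = -1 := by
    rw [hαdef, mul_neg, ← Complex.exp_add, add_neg_cancel, Complex.exp_zero]
  have hconjα : conj α = -cexp (((u₀ * T : ℝ) : ℂ) * I) := by
    rw [hαdef, map_neg, ← Complex.exp_conj, map_neg, map_mul, Complex.conj_ofReal, Complex.conj_I,
      mul_neg, neg_neg]
  have he2 : cexp (-(((u₀ * T : ℝ) : ℂ) * I)) * conj α = -1 := by
    rw [hconjα, mul_neg, ← Complex.exp_add, neg_add_cancel, Complex.exp_zero]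
  have hV : ((T : ℝ) : ℂ) * ((((2 * (-a + ℓ - -a) : ℝ)) : ℂ) +
        ((Real.exp (δ * T) : ℝ) : ℂ) * cexp (((u₀ * T : ℝ) : ℂ) * I) * ((((-a + ℓ - -a : ℝ)) : ℂ) * α) +
        ((Real.exp (-(δ * T)) : ℝ) : ℂ) * cexp (-(((u₀ * T : ℝ) : ℂ) * I)) *
          conj ((((-a + ℓ - -a : ℝ)) : ℂ) * α)) =
      (((T * ℓ * (2 - Real.exp (δ * T) - Real.exp (-(δ * T))) : ℝ)) : ℂ) := by
    have e1 : ((Real.exp (δ * T) : ℝ) : ℂ) * cexp (((u₀ * T : ℝ) : ℂ) * I) * ((((-a + ℓ - -a : ℝ)) : ℂ) * α) =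
        -(((Real.exp (δ * T) : ℝ) : ℂ) * (((-a + ℓ - -a : ℝ)) : ℂ)) := by
      calc ((Real.exp (δ * T) : ℝ) : ℂ) * cexp (((u₀ * T : ℝ) : ℂ) * I) * ((((-a + ℓ - -a : ℝ)) : ℂ) * α)
          = ((Real.exp (δ * T) : ℝ) : ℂ) * (((-a + ℓ - -a : ℝ)) : ℂ) * (cexp (((u₀ * T : ℝ) : ℂ) * I) * α) := by
            ring
        _ = _ := by rw [he1]; ring
    have e2 : ((Real.exp (-(δ * T)) : ℝ) : ℂ) * cexp (-(((u₀ * T : ℝ) : ℂ) * I)) *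
        conj ((((-a + ℓ - -a : ℝ)) : ℂ) * α) =
        -(((Real.exp (-(δ * T)) : ℝ) : ℂ) * (((-a + ℓ - -a : ℝ)) : ℂ)) := by
      rw [map_mul, Complex.conj_ofReal]
      calc ((Real.exp (-(δ * T)) : ℝ) : ℂ) * cexp (-(((u₀ * T : ℝ) : ℂ) * I)) * ((((-a + ℓ - -a : ℝ)) : ℂ) * conj α)
          = ((Real.exp (-(δ * T)) : ℝ) : ℂ) * (((-a + ℓ - -a : ℝ)) : ℂ) *
              (cexp (-(((u₀ * T : ℝ) : ℂ) * I)) * conj α) := by ring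
        _ = _ := by rw [he2]; ring
    rw [e1, e2]
    push_cast
    ring
  rw [hV, Complex.ofReal_re] at h2
  have hcosh : 2 * (T * ℓ * (2 - Real.exp (δ * T) - Real.exp (-(δ * T)))) =
      4 * T * ℓ * (1 - Real.cosh (δ * T)) := by
    rw [Real.cosh_eq]
    ring
  rw [hcosh] at h2
  exact h2

/-- The value in `soloBlind_pairLattice_visible` is negative for `δ ≠ 0`: off the line, the pair lattice
of ordinate spacing `s ∈ (π/a, 2π/a]` makes the window functional negative. -/
theorem soloBlind_pairLattice_visible_neg (a s δ : ℝ) (ha : 0 < a) (hs1 : π / a < s) (hδ : δ ≠ 0) :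
    4 * (2 * π / s) * (2 * a - 2 * π / s) * (1 - Real.cosh (δ * (2 * π / s))) < 0 := by
  have hπ : 0 < π := Real.pi_pos
  have hs : 0 < s := lt_trans (by positivity) hs1
  have hT : 0 < 2 * π / s := by positivity
  have hT2a : 2 * π / s < 2 * a := by
    rw [div_lt_iff₀ hs]
    rw [div_lt_iff₀ ha] at hs1
    linarith
  have hℓ : 0 < 2 * a - 2 * π / s := by linarith
  have hc : 1 < Real.cosh (δ * (2 * π / s)) := Real.one_lt_cosh.mpr (mul_ne_zero hδ hT.ne')
  have h1 : 0 < 4 * (2 * π / s) * (2 * a - 2 * π / s) := by positivity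
  have h2 : 1 - Real.cosh (δ * (2 * π / s)) < 0 := by linarith
  exact mul_neg_of_pos_of_neg h1 h2

end Summit.RiemannHypothesis.RiemannHypothesis.Theorems
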